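import Summits.CriticalPhenomena.CardyFormulaZ2.Theorems.CardyBoundaryCoulombGasBoundaryDefectGaussianRStubReferenceLimitPart6
import Literature.Probability.LatticeModels.CollarLegModel
import Literature.Probability.LatticeModels.DirichletGreenFunction
import Literature.Probability.RandomPlanarGeometry.PlanarDomains

/-!
# Stub `stub_referenceLimitV2` of line `rainbow-monomials-in-excursion-kernels` — Part 7:
# the corrected reference limit REFV2 from RIGIDITY and ONE canonical limit

Crux `BoundaryDefectGaussianR` (stmt-CriticalPhenomena-14132). The registered stub `stub_referenceLimitV2`
(REFV2) asks, for every non-degenerate leg family `(k, L, j)`, for a rectilinear marked domain `D₀` with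
flat marks, positively oriented at the sink, APPROXIMABLE by admissible injective lattice data, on which
the Green-normalised rainbow functional `F_V(p) = log(‖Zins‖/‖Z‖) − Λ_V(p)` has a LIMIT `ℓ` along EVERY
admissible injective configuration sequence converging to the marks. This file reduces the whole of
REFV2 to the convergence of ONE explicit family of numerical sequences (CANON): with `D₀` the reference
square `(-1, 1)²` of Parts 4 and 6 (marks `x_i - i`, `x_i = 2(i+1)/(k+1) - 1`), its lattice boxes
`V_n = [-⌊1/δ_n⌋₊, ⌊1/δ_n⌋₊]²` and the canonical bottom-row configurations
`p_n i = (⌊x_i/δ_n⌋, -⌊1/δ_n⌋₊)`, CANON says that `F_{V_n}(p_n)` converges, to a limit independent of the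
mesh sequence `δ_n → 0⁺` (injectivity and admissibility of `p_n`, true from some index on by Part 6, are
granted for all `n`). RIGIDITY — the first hypothesis of the landed glue `stub_transferV2` verbatim, and
the conclusion of the landed `s3_rigidityOfTransportV2` — transfers this one limit to every admissible
injective convergent configuration sequence on the same square.

* `refV2_limit_transfer` / `s12_refV2_of_canonicalLimit` (registered sub-goal) — the transfer in abstract
  form: self-rigidity of a functional `F` on a set `S` + canonical data (convergent, eventually injective
  and admissible) + the canonical limit `ℓ` ⟹ `S` is APPROXIMABLE and `F → ℓ` along every admissible
  injective convergent sequence (shift the canonical sequence past the index where it becomes admissible,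
  subtract);
* `refV2_of_canonicalLimit : RIGIDITY → CANON → REFV2` — the reduction; after it the open content of
  `stub_referenceLimitV2` is exactly CANON (sharp Green-normalised rainbow asymptotics for one
  configuration per mesh on the boxes of `ℤ²`), given the RIGIDITY the skeleton derives from the other stubs.
-/

noncomputable section

namespace Summit.CriticalPhenomena.CardyFormulaZ2.Cruxes.BoundaryDefectGaussianR.RainbowMonomialsInExcursionKernels

open Filter Topology Set
open Literature.Probability.RandomPlanarGeometry Literature.Probability.LatticeModels
  Literature.Probability.LatticeModels.CollarLegModel

/-! ### The transfer: canonical limit + self-rigidity ⟹ approximability and the limit along every sequence -/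

/-- **The transfer in abstract form** (pretty twin of the registered sub-goal). For a functional `F` of a
lattice domain and a configuration, an admissibility predicate `A`, target points `x` and a closed set `S`
discretised at meshes `δ_n → 0⁺` (`V_n = {v : δ_n v ∈ S}`): if `F` is SELF-RIGID on `S` (its values along
two admissible injective configuration sequences converging to `x` are asymptotically equal), the canonical
configurations `q(δ_n)` converge to `x` and are injective and admissible from some index on, and `F` tends
to `ℓ` along the canonical configurations of every mesh sequence (granted injectivity and admissibility),
then `S` is APPROXIMABLE and `F → ℓ` along EVERY admissible injective configuration sequence converging to
`x`. Proof: shift the canonical sequence past the index where it becomes admissible, subtract. [folklore] -/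
theorem refV2_limit_transfer (k : ℕ) (S : Set ℂ) (x : Fin k → ℂ) (A : Finset (ℤ × ℤ) → (Fin k → ℤ × ℤ) → Prop)
    (F : Finset (ℤ × ℤ) → (Fin k → ℤ × ℤ) → ℝ) (q : ℝ → Fin k → ℤ × ℤ) (ℓ : ℝ)
    (hR : ∀ (δ : ℕ → ℝ), (∀ n, 0 < δ n) → Tendsto δ atTop (𝓝 0) → ∀ (V : ℕ → Finset (ℤ × ℤ)),
      (∀ n, ∀ v : ℤ × ℤ, v ∈ V n ↔ ((v.1 : ℂ) * ((δ n : ℝ) : ℂ) + (v.2 : ℂ) * ((δ n : ℝ) : ℂ) * Complex.I) ∈ S) →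
      ∀ (p p' : ℕ → Fin k → ℤ × ℤ), (∀ n, Function.Injective (p n)) → (∀ n, Function.Injective (p' n)) →
      (∀ i, Tendsto (fun n ↦ (((p n i).1 : ℂ) * ((δ n : ℝ) : ℂ) + ((p n i).2 : ℂ) * ((δ n : ℝ) : ℂ) * Complex.I))
        atTop (𝓝 (x i))) →
      (∀ i, Tendsto (fun n ↦ (((p' n i).1 : ℂ) * ((δ n : ℝ) : ℂ) + ((p' n i).2 : ℂ) * ((δ n : ℝ) : ℂ) * Complex.I))
        atTop (𝓝 (x i))) →
      (∀ n, A (V n) (p n)) → (∀ n, A (V n) (p' n)) →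
      Tendsto (fun n ↦ F (V n) (p n) - F (V n) (p' n)) atTop (𝓝 0))
    (hD : ∀ (δ : ℕ → ℝ), (∀ n, 0 < δ n) → Tendsto δ atTop (𝓝 0) → ∀ (V : ℕ → Finset (ℤ × ℤ)),
      (∀ n, ∀ v : ℤ × ℤ, v ∈ V n ↔ ((v.1 : ℂ) * ((δ n : ℝ) : ℂ) + (v.2 : ℂ) * ((δ n : ℝ) : ℂ) * Complex.I) ∈ S) →
      (∀ i, Tendsto (fun n ↦ (((q (δ n) i).1 : ℂ) * ((δ n : ℝ) : ℂ) + ((q (δ n) i).2 : ℂ) * ((δ n : ℝ) : ℂ) *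
        Complex.I)) atTop (𝓝 (x i))) ∧
      ∃ N : ℕ, ∀ n, N ≤ n → Function.Injective (q (δ n)) ∧ A (V n) (q (δ n)))
    (hC : ∀ (δ : ℕ → ℝ), (∀ n, 0 < δ n) → Tendsto δ atTop (𝓝 0) → ∀ (V : ℕ → Finset (ℤ × ℤ)),
      (∀ n, ∀ v : ℤ × ℤ, v ∈ V n ↔ ((v.1 : ℂ) * ((δ n : ℝ) : ℂ) + (v.2 : ℂ) * ((δ n : ℝ) : ℂ) * Complex.I) ∈ S) →
      ∀ (p : ℕ → Fin k → ℤ × ℤ), (∀ n i, p n i = q (δ n) i) → (∀ n, Function.Injective (p n)) →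
      (∀ n, A (V n) (p n)) → Tendsto (fun n ↦ F (V n) (p n)) atTop (𝓝 ℓ)) :
    (∀ (δ : ℕ → ℝ), (∀ n, 0 < δ n) → Tendsto δ atTop (𝓝 0) → ∀ (V : ℕ → Finset (ℤ × ℤ)),
      (∀ n, ∀ v : ℤ × ℤ, v ∈ V n ↔ ((v.1 : ℂ) * ((δ n : ℝ) : ℂ) + (v.2 : ℂ) * ((δ n : ℝ) : ℂ) * Complex.I) ∈ S) →
      ∃ p : ℕ → Fin k → ℤ × ℤ, (∀ n, Function.Injective (p n)) ∧
      (∀ i, Tendsto (fun n ↦ (((p n i).1 : ℂ) * ((δ n : ℝ) : ℂ) + ((p n i).2 : ℂ) * ((δ n : ℝ) : ℂ) * Complex.I))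
        atTop (𝓝 (x i))) ∧
      ∃ N : ℕ, ∀ n, N ≤ n → A (V n) (p n)) ∧
    (∀ (δ : ℕ → ℝ), (∀ n, 0 < δ n) → Tendsto δ atTop (𝓝 0) → ∀ (V : ℕ → Finset (ℤ × ℤ)),
      (∀ n, ∀ v : ℤ × ℤ, v ∈ V n ↔ ((v.1 : ℂ) * ((δ n : ℝ) : ℂ) + (v.2 : ℂ) * ((δ n : ℝ) : ℂ) * Complex.I) ∈ S) →
      ∀ (p : ℕ → Fin k → ℤ × ℤ), (∀ n, Function.Injective (p n)) →
      (∀ i, Tendsto (fun n ↦ (((p n i).1 : ℂ) * ((δ n : ℝ) : ℂ) + ((p n i).2 : ℂ) * ((δ n : ℝ) : ℂ) * Complex.I))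
        atTop (𝓝 (x i))) →
      (∀ n, A (V n) (p n)) → Tendsto (fun n ↦ F (V n) (p n)) atTop (𝓝 ℓ)) := by
  classical
  refine ⟨fun δ hδ hδ0 V hV ↦ ?_, fun δ hδ hδ0 V hV p hp hc ha ↦ ?_⟩
  · -- APPROXIMABLE: the canonical configuration from index `N` on, a fixed injective one before
    obtain ⟨hconv, N, hN⟩ := hD δ hδ hδ0 V hV
    refine ⟨fun n i ↦ if N ≤ n then q (δ n) i else (((i : ℕ) : ℤ), 0), fun n ↦ ?_, fun i ↦ ?_, N,
      fun n hn ↦ ?_⟩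
    · intro i i' h
      by_cases hn : N ≤ n
      · simp only [if_pos hn] at h
        exact (hN n hn).1 h
      · simp only [if_neg hn, Prod.mk.injEq, Nat.cast_inj, and_true] at h
        exact Fin.ext h
    · refine (hconv i).congr' ?_
      rw [EventuallyEq, eventually_atTop]
      exact ⟨N, fun n hn ↦ by simp only [if_pos hn]⟩
    · simp only [if_pos hn]
      exact (hN n hn).2
  · -- LIMIT: rigidity against the shifted canonical sequence, plus the canonical limit
    obtain ⟨hconv, N, hN⟩ := hD δ hδ hδ0 V hV
    have hδ' : ∀ n, 0 < δ (n + N) := fun n ↦ hδ _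
    have hδ0' : Filter.Tendsto (fun n ↦ δ (n + N)) Filter.atTop (nhds 0) := hδ0.comp (tendsto_add_atTop_nat N)
    have h1 := hR (fun n ↦ δ (n + N)) hδ' hδ0' (fun n ↦ V (n + N)) (fun n ↦ hV (n + N)) (fun n ↦ p (n + N))
      (fun n ↦ q (δ (n + N))) (fun n ↦ hp (n + N)) (fun n ↦ (hN (n + N) (Nat.le_add_left N n)).1)
      (fun i ↦ (hc i).comp (tendsto_add_atTop_nat N)) (fun i ↦ (hconv i).comp (tendsto_add_atTop_nat N))
      (fun n ↦ ha (n + N)) (fun n ↦ (hN (n + N) (Nat.le_add_left N n)).2)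
    have h2 := hC (fun n ↦ δ (n + N)) hδ' hδ0' (fun n ↦ V (n + N)) (fun n ↦ hV (n + N))
      (fun n ↦ q (δ (n + N))) (fun n i ↦ rfl) (fun n ↦ (hN (n + N) (Nat.le_add_left N n)).1)
      (fun n ↦ (hN (n + N) (Nat.le_add_left N n)).2)
    rw [← zero_add ℓ]
    refine (Filter.tendsto_add_atTop_iff_nat N).mp ?_
    exact (h1.add h2).congr (fun n ↦ sub_add_cancel _ _)

/-- **Registered sub-goal `s12_refV2_of_canonicalLimit`** of `stub_referenceLimitV2` (one-line form of
`refV2_limit_transfer`): APPROXIMABILITY and the LIMIT conjunct of REFV2 for a reference set `S` follow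
from self-rigidity of the functional on `S`, the canonical data, and the ONE canonical limit. [folklore] -/
theorem s12_refV2_of_canonicalLimit : ∀ (k : ℕ) (S : Set ℂ) (x : Fin k → ℂ) (A : Finset (ℤ × ℤ) → (Fin k → ℤ × ℤ) → Prop) (F : Finset (ℤ × ℤ) → (Fin k → ℤ × ℤ) → ℝ) (q : ℝ → Fin k → ℤ × ℤ) (ℓ : ℝ), (∀ (δ : ℕ → ℝ), (∀ n, 0 < δ n) → Filter.Tendsto δ Filter.atTop (nhds 0) → ∀ (V : ℕ → Finset (ℤ × ℤ)), (∀ n, ∀ v : ℤ × ℤ, v ∈ V n ↔ (((v).1 : ℂ) * ((δ n : ℝ) : ℂ) + ((v).2 : ℂ) * ((δ n : ℝ) : ℂ) * Complex.I) ∈ S) → ∀ (p p' : ℕ → Fin k → ℤ × ℤ), (∀ n, Function.Injective (p n)) → (∀ n, Function.Injective (p' n)) → (∀ i, Filter.Tendsto (fun n ↦ ((((p) n i).1 : ℂ) * ((δ n : ℝ) : ℂ) + (((p) n i).2 : ℂ) * ((δ n : ℝ) : ℂ) * Complex.I)) Filter.atTop (nhds (x i))) → (∀ i, Filter.Tendsto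 (fun n ↦ ((((p') n i).1 : ℂ) * ((δ n : ℝ) : ℂ) + (((p') n i).2 : ℂ) * ((δ n : ℝ) : ℂ) * Complex.I)) Filter.atTop (nhds (x i))) → (∀ n, A (V n) (p n)) → (∀ n, A (V n) (p' n)) → Filter.Tendsto (fun n ↦ F (V n) (p n) - F (V n) (p' n)) Filter.atTop (nhds 0)) → (∀ (δ : ℕ → ℝ), (∀ n, 0 < δ n) → Filter.Tendsto δ Filter.atTop (nhds 0) → ∀ (V : ℕ → Finset (ℤ × ℤ)), (∀ n, ∀ v : ℤ × ℤ, v ∈ V n ↔ (((v).1 : ℂ) * ((δ n : ℝ) : ℂ) + ((v).2 : ℂ) * ((δ n : ℝ) : ℂ) * Complex.I) ∈ S) → (∀ i, Filter.Tendsto (fun n ↦ (((q (δ n) i).1 : ℂ) * ((δ n : ℝ) : ℂ) + ((q (δ n) i).2 : ℂ) * ((δ n : ℝ) : ℂ) * Complex.I)) Filter.atTop (nhds (x i))) ∧ ∃ N : ℕ, ∀ n, N ≤ n → Function.Injective (q (δ n)) ∧ A (V n) (q (δ n))) → (∀ (δ : ℕ → ℝ), (∀ n, 0 < δ n) → Filter.Tendsto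 δ Filter.atTop (nhds 0) → ∀ (V : ℕ → Finset (ℤ × ℤ)), (∀ n, ∀ v : ℤ × ℤ, v ∈ V n ↔ (((v).1 : ℂ) * ((δ n : ℝ) : ℂ) + ((v).2 : ℂ) * ((δ n : ℝ) : ℂ) * Complex.I) ∈ S) → ∀ (p : ℕ → Fin k → ℤ × ℤ), (∀ n i, p n i = q (δ n) i) → (∀ n, Function.Injective (p n)) → (∀ n, A (V n) (p n)) → Filter.Tendsto (fun n ↦ F (V n) (p n)) Filter.atTop (nhds ℓ)) → (∀ (δ : ℕ → ℝ), (∀ n, 0 < δ n) → Filter.Tendsto δ Filter.atTop (nhds 0) → ∀ (V : ℕ → Finset (ℤ × ℤ)), (∀ n, ∀ v : ℤ × ℤ, v ∈ V n ↔ (((v).1 : ℂ) * ((δ n : ℝ) : ℂ) + ((v).2 : ℂ) * ((δ n : ℝ) : ℂ) * Complex.I) ∈ S) → ∃ p : ℕ → Fin k → ℤ × ℤ, (∀ n, Function.Injective ((p) n)) ∧ (∀ i, Filter.Tendsto (fun n ↦ ((((p) n i).1 : ℂ) * ((δ n : ℝ) : ℂ) + (((p) n i).2 : ℂ) * ((δ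 n : ℝ) : ℂ) * Complex.I)) Filter.atTop (nhds (x i))) ∧ ∃ N : ℕ, ∀ n, N ≤ n → A (V n) (p n)) ∧ (∀ (δ : ℕ → ℝ), (∀ n, 0 < δ n) → Filter.Tendsto δ Filter.atTop (nhds 0) → ∀ (V : ℕ → Finset (ℤ × ℤ)), (∀ n, ∀ v : ℤ × ℤ, v ∈ V n ↔ (((v).1 : ℂ) * ((δ n : ℝ) : ℂ) + ((v).2 : ℂ) * ((δ n : ℝ) : ℂ) * Complex.I) ∈ S) → ∀ (p : ℕ → Fin k → ℤ × ℤ), (∀ n, Function.Injective ((p) n)) → (∀ i, Filter.Tendsto (fun n ↦ ((((p) n i).1 : ℂ) * ((δ n : ℝ) : ℂ) + (((p) n i).2 : ℂ) * ((δ n : ℝ) : ℂ) * Complex.I)) Filter.atTop (nhds (x i))) → (∀ n, A (V n) (p n)) → Filter.Tendsto (fun n ↦ F (V n) (p n)) Filter.atTop (nhds ℓ)) :=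
  refV2_limit_transfer

/-- **Stub 4′ reduced: `RIGIDITY → CANON → REFV2`.** RIGIDITY is the first hypothesis of the landed
`stub_transferV2` verbatim (two rectilinear marked domains with flat marks, positively oriented at the
sink, one mesh sequence, admissible injective configurations converging to the marks ⟹ eventually positive
rainbow ratios and `F_n − F'_n → 0`); CANON is the convergence, to a limit independent of the mesh sequence
`δ_n → 0⁺`, of the ONE numerical family `F_{V_n}(p_n)` on the boxes `V_n = [-⌊1/δ_n⌋₊, ⌊1/δ_n⌋₊]²` at the
canonical configurations `p_n i = (⌊x_i/δ_n⌋, -⌊1/δ_n⌋₊)`, `x_i = 2(i+1)/(k+1) - 1` (injectivity and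
admissibility granted); REFV2 is the registered statement of `stub_referenceLimitV2` verbatim, witnessed
by the reference square of Part 4. Proof: `refSquare_geometry`, `canonical_tendsto`, `canonical_eventually`,
`square_latticeBox`, and `refV2_limit_transfer` with RIGIDITY specialised to `D = D' =` the square. [folklore] -/
theorem refV2_of_canonicalLimit :
    (∀ (k : ℕ) (L : Fin k → ℕ) (j : Fin k), L j = ∑ i ∈ Finset.univ.erase j, L i → ∀ (D D' :
    Literature.Probability.RandomPlanarGeometry.MarkedDomain k), (∃ S : Finset (ℂ × ℂ), (∀ q ∈ S, q.1.re
    = q.2.re ∨ q.1.im = q.2.im) ∧ frontier D.carrier ⊆ ⋃ q ∈ S, segment ℝ q.1 q.2) → (∀ i, (∃ r : ℝ, 0 <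
    r ∧ ((∀ z ∈ frontier D.carrier, dist z (D.pt i) < r → z.im = (D.pt i).im) ∨ (∀ z ∈ frontier
    D.carrier, dist z (D.pt i) < r → z.re = (D.pt i).re)))) → (∃ τ : ℂ, ‖τ‖ = 1 ∧ (∃ ε : ℝ, 0 < ε ∧ ∀ t ∈
    Set.Ioo (D.mark j) (D.mark j + ε), ∃ s : ℝ, 0 < s ∧ D.boundary t = D.pt j + (s : ℂ) * τ) ∧ (∃ ε : ℝ,
    0 < ε ∧ ∀ s ∈ Set.Ioo (0 : ℝ) ε, D.pt j + (s : ℂ) * (τ * Complex.I) ∈ D.carrier)) → (∃ S : Finset (ℂ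
    × ℂ), (∀ q ∈ S, q.1.re = q.2.re ∨ q.1.im = q.2.im) ∧ frontier D'.carrier ⊆ ⋃ q ∈ S, segment ℝ q.1
    q.2) → (∀ i, (∃ r : ℝ, 0 < r ∧ ((∀ z ∈ frontier D'.carrier, dist z (D'.pt i) < r → z.im = (D'.pt
    i).im) ∨ (∀ z ∈ frontier D'.carrier, dist z (D'.pt i) < r → z.re = (D'.pt i).re)))) → (∃ τ : ℂ, ‖τ‖ =
    1 ∧ (∃ ε : ℝ, 0 < ε ∧ ∀ t ∈ Set.Ioo (D'.mark j) (D'.mark j + ε), ∃ s : ℝ, 0 < s ∧ D'.boundary t =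
    D'.pt j + (s : ℂ) * τ) ∧ (∃ ε : ℝ, 0 < ε ∧ ∀ s ∈ Set.Ioo (0 : ℝ) ε, D'.pt j + (s : ℂ) * (τ *
    Complex.I) ∈ D'.carrier)) → ∀ (δ : ℕ → ℝ), (∀ n, 0 < δ n) → Filter.Tendsto δ Filter.atTop (nhds 0) →
    ∀ (V V' : ℕ → Finset (ℤ × ℤ)), (∀ n, ∀ v : ℤ × ℤ, v ∈ V n ↔ (((v).1 : ℂ) * ((δ n : ℝ) : ℂ) + ((v).2 :
    ℂ) * ((δ n : ℝ) : ℂ) * Complex.I) ∈ closure D.carrier) → (∀ n, ∀ v : ℤ × ℤ, v ∈ V' n ↔ (((v).1 : ℂ) *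
    ((δ n : ℝ) : ℂ) + ((v).2 : ℂ) * ((δ n : ℝ) : ℂ) * Complex.I) ∈ closure D'.carrier) → ∀ (p p' : ℕ →
    Fin k → ℤ × ℤ), (∀ n, Function.Injective ((p) n)) → (∀ n, Function.Injective ((p') n)) → (∀ i,
    Filter.Tendsto (fun n ↦ ((((p) n i).1 : ℂ) * ((δ n : ℝ) : ℂ) + (((p) n i).2 : ℂ) * ((δ n : ℝ) : ℂ) *
    Complex.I)) Filter.atTop (nhds (D.pt i))) → (∀ i, Filter.Tendsto (fun n ↦ ((((p') n i).1 : ℂ) * ((δ n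
    : ℝ) : ℂ) + (((p') n i).2 : ℂ) * ((δ n : ℝ) : ℂ) * Complex.I)) Filter.atTop (nhds (D'.pt i))) → (∀ n,
    Literature.Probability.LatticeModels.CollarLegModel.LegInsertionData.IsAdmissible
    (⟨(Finset.univ.erase j).image ((p) n), fun v ↦ ∑ b ∈ (Finset.univ.erase j).filter (fun b ↦ ((p) n) b
    = v), L b, ((p) n) j⟩ : Literature.Probability.LatticeModels.CollarLegModel.LegInsertionData) (V n))
    → (∀ n, Literature.Probability.LatticeModels.CollarLegModel.LegInsertionData.IsAdmissible
    (⟨(Finset.univ.erase j).image ((p') n), fun v ↦ ∑ b ∈ (Finset.univ.erase j).filter (fun b ↦ ((p') n)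
    b = v), L b, ((p') n) j⟩ : Literature.Probability.LatticeModels.CollarLegModel.LegInsertionData) (V'
    n)) → (∀ᶠ n in Filter.atTop, 0 < (‖Literature.Probability.LatticeModels.CollarLegModel.Zins (V n)
    (⟨(Finset.univ.erase j).image (p n), fun v ↦ ∑ b ∈ (Finset.univ.erase j).filter (fun b ↦ (p n) b =
    v), L b, (p n) j⟩ : Literature.Probability.LatticeModels.CollarLegModel.LegInsertionData)‖ /
    ‖(Literature.Probability.LatticeModels.CollarLegModel.ofDomain (V n)).Z‖)) ∧ Filter.Tendsto (fun n ↦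
    (Real.log (‖Literature.Probability.LatticeModels.CollarLegModel.Zins (V n) (⟨(Finset.univ.erase
    j).image (p n), fun v ↦ ∑ b ∈ (Finset.univ.erase j).filter (fun b ↦ (p n) b = v), L b, (p n) j⟩ :
    Literature.Probability.LatticeModels.CollarLegModel.LegInsertionData)‖ /
    ‖(Literature.Probability.LatticeModels.CollarLegModel.ofDomain (V n)).Z‖) - (∑ i₁ : Fin k, ∑ i₂ ∈
    Finset.univ.filter (fun i₂ : Fin k ↦ i₁ < i₂), (-((if i₁ = j then (1 - (L j : ℝ)) else (L i₁ : ℝ)) *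
    (if i₂ = j then (1 - (L j : ℝ)) else (L i₂ : ℝ))) / 6) * Real.log
    (Literature.Probability.LatticeModels.dirichletGreen ((V n).image (fun v : ℤ × ℤ ↦ (![v.1, v.2] : Fin
    2 → ℤ))) (![((p n) i₁).1, ((p n) i₁).2] : Fin 2 → ℤ) (![((p n) i₂).1, ((p n) i₂).2] : Fin 2 → ℤ)))) -
    (Real.log (‖Literature.Probability.LatticeModels.CollarLegModel.Zins (V' n) (⟨(Finset.univ.erase
    j).image (p' n), fun v ↦ ∑ b ∈ (Finset.univ.erase j).filter (fun b ↦ (p' n) b = v), L b, (p' n) j⟩ :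
    Literature.Probability.LatticeModels.CollarLegModel.LegInsertionData)‖ /
    ‖(Literature.Probability.LatticeModels.CollarLegModel.ofDomain (V' n)).Z‖) - (∑ i₁ : Fin k, ∑ i₂ ∈
    Finset.univ.filter (fun i₂ : Fin k ↦ i₁ < i₂), (-((if i₁ = j then (1 - (L j : ℝ)) else (L i₁ : ℝ)) *
    (if i₂ = j then (1 - (L j : ℝ)) else (L i₂ : ℝ))) / 6) * Real.log
    (Literature.Probability.LatticeModels.dirichletGreen ((V' n).image (fun v : ℤ × ℤ ↦ (![v.1, v.2] :
    Fin 2 → ℤ))) (![((p' n) i₁).1, ((p' n) i₁).2] : Fin 2 → ℤ) (![((p' n) i₂).1, ((p' n) i₂).2] : Fin 2 →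
    ℤ))))) Filter.atTop (nhds 0)) → (∀ (k : ℕ) (L : Fin k → ℕ) (j : Fin k), L j = ∑ i ∈ Finset.univ.erase
    j, L i → (∃ i, i ≠ j) → (∀ i, i ≠ j → 1 ≤ L i) → ∃ ℓ : ℝ, ∀ (δ : ℕ → ℝ), (∀ n, 0 < δ n) →
    Filter.Tendsto δ Filter.atTop (nhds 0) → ∀ (V : ℕ → Finset (ℤ × ℤ)), (∀ n, ∀ v : ℤ × ℤ, v ∈ V n ↔
    (-(⌊1 / δ n⌋₊ : ℤ) ≤ v.1 ∧ v.1 ≤ ⌊1 / δ n⌋₊) ∧ (-(⌊1 / δ n⌋₊ : ℤ) ≤ v.2 ∧ v.2 ≤ ⌊1 / δ n⌋₊)) → ∀ (p :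
    ℕ → Fin k → ℤ × ℤ), (∀ n i, p n i = (⌊(2 * ((i : ℝ) + 1) / (k + 1) - 1) / δ n⌋, -(⌊1 / δ n⌋₊ : ℤ))) →
    (∀ n, Function.Injective (p n)) → (∀ n,
    Literature.Probability.LatticeModels.CollarLegModel.LegInsertionData.IsAdmissible
    (⟨(Finset.univ.erase j).image (p n), fun v ↦ ∑ b ∈ (Finset.univ.erase j).filter (fun b ↦ (p n) b =
    v), L b, (p n) j⟩ : Literature.Probability.LatticeModels.CollarLegModel.LegInsertionData) (V n)) →
    Filter.Tendsto (fun n ↦ (Real.log (‖Literature.Probability.LatticeModels.CollarLegModel.Zins (V n)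
    (⟨(Finset.univ.erase j).image (p n), fun v ↦ ∑ b ∈ (Finset.univ.erase j).filter (fun b ↦ (p n) b =
    v), L b, (p n) j⟩ : Literature.Probability.LatticeModels.CollarLegModel.LegInsertionData)‖ /
    ‖(Literature.Probability.LatticeModels.CollarLegModel.ofDomain (V n)).Z‖) - (∑ i₁ : Fin k, ∑ i₂ ∈
    Finset.univ.filter (fun i₂ : Fin k ↦ i₁ < i₂), (-((if i₁ = j then (1 - (L j : ℝ)) else (L i₁ : ℝ)) *
    (if i₂ = j then (1 - (L j : ℝ)) else (L i₂ : ℝ))) / 6) * Real.log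
    (Literature.Probability.LatticeModels.dirichletGreen ((V n).image (fun v : ℤ × ℤ ↦ (![v.1, v.2] : Fin
    2 → ℤ))) (![((p n) i₁).1, ((p n) i₁).2] : Fin 2 → ℤ) (![((p n) i₂).1, ((p n) i₂).2] : Fin 2 → ℤ)))))
    Filter.atTop (nhds ℓ)) → (∀ (k : ℕ) (L : Fin k → ℕ) (j : Fin k), L j = ∑ i ∈ Finset.univ.erase j, L i
    → (∃ i, i ≠ j) → (∀ i, i ≠ j → 1 ≤ L i) → ∃ D₀ :
    Literature.Probability.RandomPlanarGeometry.MarkedDomain k, (∃ S : Finset (ℂ × ℂ), (∀ q ∈ S, q.1.re =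
    q.2.re ∨ q.1.im = q.2.im) ∧ frontier D₀.carrier ⊆ ⋃ q ∈ S, segment ℝ q.1 q.2) ∧ (∀ i, (∃ r : ℝ, 0 < r
    ∧ ((∀ z ∈ frontier D₀.carrier, dist z (D₀.pt i) < r → z.im = (D₀.pt i).im) ∨ (∀ z ∈ frontier
    D₀.carrier, dist z (D₀.pt i) < r → z.re = (D₀.pt i).re)))) ∧ (∃ τ : ℂ, ‖τ‖ = 1 ∧ (∃ ε : ℝ, 0 < ε ∧ ∀
    t ∈ Set.Ioo (D₀.mark j) (D₀.mark j + ε), ∃ s : ℝ, 0 < s ∧ D₀.boundary t = D₀.pt j + (s : ℂ) * τ) ∧ (∃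
    ε : ℝ, 0 < ε ∧ ∀ s ∈ Set.Ioo (0 : ℝ) ε, D₀.pt j + (s : ℂ) * (τ * Complex.I) ∈ D₀.carrier)) ∧ (∀ (δ :
    ℕ → ℝ), (∀ n, 0 < δ n) → Filter.Tendsto δ Filter.atTop (nhds 0) → ∀ (V : ℕ → Finset (ℤ × ℤ)), (∀ n, ∀
    v : ℤ × ℤ, v ∈ V n ↔ (((v).1 : ℂ) * ((δ n : ℝ) : ℂ) + ((v).2 : ℂ) * ((δ n : ℝ) : ℂ) * Complex.I) ∈
    closure D₀.carrier) → ∃ p : ℕ → Fin k → ℤ × ℤ, (∀ n, Function.Injective ((p) n)) ∧ (∀ i,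
    Filter.Tendsto (fun n ↦ ((((p) n i).1 : ℂ) * ((δ n : ℝ) : ℂ) + (((p) n i).2 : ℂ) * ((δ n : ℝ) : ℂ) *
    Complex.I)) Filter.atTop (nhds (D₀.pt i))) ∧ ∃ N : ℕ, ∀ n, N ≤ n →
    Literature.Probability.LatticeModels.CollarLegModel.LegInsertionData.IsAdmissible
    (⟨(Finset.univ.erase j).image (p n), fun v ↦ ∑ b ∈ (Finset.univ.erase j).filter (fun b ↦ (p n) b =
    v), L b, (p n) j⟩ : Literature.Probability.LatticeModels.CollarLegModel.LegInsertionData) (V n)) ∧ ∃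
    ℓ : ℝ, ∀ (δ : ℕ → ℝ), (∀ n, 0 < δ n) → Filter.Tendsto δ Filter.atTop (nhds 0) → ∀ (V : ℕ → Finset (ℤ
    × ℤ)), (∀ n, ∀ v : ℤ × ℤ, v ∈ V n ↔ (((v).1 : ℂ) * ((δ n : ℝ) : ℂ) + ((v).2 : ℂ) * ((δ n : ℝ) : ℂ) *
    Complex.I) ∈ closure D₀.carrier) → ∀ (p : ℕ → Fin k → ℤ × ℤ), (∀ n, Function.Injective ((p) n)) → (∀
    i, Filter.Tendsto (fun n ↦ ((((p) n i).1 : ℂ) * ((δ n : ℝ) : ℂ) + (((p) n i).2 : ℂ) * ((δ n : ℝ) : ℂ)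
    * Complex.I)) Filter.atTop (nhds (D₀.pt i))) → (∀ n,
    Literature.Probability.LatticeModels.CollarLegModel.LegInsertionData.IsAdmissible
    (⟨(Finset.univ.erase j).image ((p) n), fun v ↦ ∑ b ∈ (Finset.univ.erase j).filter (fun b ↦ ((p) n) b
    = v), L b, ((p) n) j⟩ : Literature.Probability.LatticeModels.CollarLegModel.LegInsertionData) (V n))
    → Filter.Tendsto (fun n ↦ (Real.log (‖Literature.Probability.LatticeModels.CollarLegModel.Zins (V n)
    (⟨(Finset.univ.erase j).image (p n), fun v ↦ ∑ b ∈ (Finset.univ.erase j).filter (fun b ↦ (p n) b =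
    v), L b, (p n) j⟩ : Literature.Probability.LatticeModels.CollarLegModel.LegInsertionData)‖ /
    ‖(Literature.Probability.LatticeModels.CollarLegModel.ofDomain (V n)).Z‖) - (∑ i₁ : Fin k, ∑ i₂ ∈
    Finset.univ.filter (fun i₂ : Fin k ↦ i₁ < i₂), (-((if i₁ = j then (1 - (L j : ℝ)) else (L i₁ : ℝ)) *
    (if i₂ = j then (1 - (L j : ℝ)) else (L i₂ : ℝ))) / 6) * Real.log
    (Literature.Probability.LatticeModels.dirichletGreen ((V n).image (fun v : ℤ × ℤ ↦ (![v.1, v.2] : Fin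
    2 → ℤ))) (![((p n) i₁).1, ((p n) i₁).2] : Fin 2 → ℤ) (![((p n) i₂).1, ((p n) i₂).2] : Fin 2 → ℤ)))))
    Filter.atTop (nhds ℓ)) := by
  intro hR hC k L j hL hk hpos
  obtain ⟨ℓ, hℓ⟩ := hC k L j hL hk hpos
  let D₀ : MarkedDomain k := ⟨rectDomain 1 1 one_pos one_pos, fun i ↦ ((i : ℝ) + 1) / (4 * (k + 1)),
    square_mark_strictMono k, square_mark_mem k⟩
  obtain ⟨hrect, hflat, hor⟩ := refSquare_geometry k j D₀ rfl
  have key := refV2_limit_transfer k (closure D₀.carrier) D₀.pt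
    (fun W p ↦ LegInsertionData.IsAdmissible (⟨(Finset.univ.erase j).image p,
      fun v ↦ ∑ b ∈ (Finset.univ.erase j).filter (fun b ↦ p b = v), L b, p j⟩ : LegInsertionData) W)
    (fun W p ↦ Real.log (‖Zins W (⟨(Finset.univ.erase j).image p,
      fun v ↦ ∑ b ∈ (Finset.univ.erase j).filter (fun b ↦ p b = v), L b, p j⟩ : LegInsertionData)‖ /
      ‖(ofDomain W).Z‖) - (∑ i₁ : Fin k, ∑ i₂ ∈ Finset.univ.filter (fun i₂ : Fin k ↦ i₁ < i₂),
      (-((if i₁ = j then (1 - (L j : ℝ)) else (L i₁ : ℝ)) * (if i₂ = j then (1 - (L j : ℝ)) else (L i₂ : ℝ))) / 6) *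
      Real.log (dirichletGreen (W.image (fun v : ℤ × ℤ ↦ (![v.1, v.2] : Fin 2 → ℤ)))
      (![(p i₁).1, (p i₁).2] : Fin 2 → ℤ) (![(p i₂).1, (p i₂).2] : Fin 2 → ℤ))))
    (fun d i ↦ ((⌊(2 * ((i : ℝ) + 1) / (k + 1) - 1) / d⌋, -(⌊1 / d⌋₊ : ℤ)) : ℤ × ℤ)) ℓ
    (fun δ hδ hδ0 V hV p p' hp hp' hc hc' ha ha' ↦ (hR k L j hL D₀ D₀ hrect hflat hor hrect hflat hor δ hδ
      hδ0 V V hV hV p p' hp hp' hc hc' ha ha').2)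
    (fun δ hδ hδ0 V hV ↦ ⟨fun i ↦ canonical_tendsto_pt k D₀ rfl hδ hδ0 (fun n i ↦ rfl) i,
      canonical_eventually k L j hk hpos hδ hδ0 (fun n ↦ square_latticeBox (hδ n) (hV n)) (fun n i ↦ rfl)⟩)
    (fun δ hδ hδ0 V hV p hp hinj hadm ↦ hℓ δ hδ hδ0 V (fun n ↦ square_latticeBox (hδ n) (hV n)) p hp hinj hadm)
  exact ⟨D₀, hrect, hflat, hor, key.1, ℓ, key.2⟩

end Summit.CriticalPhenomena.CardyFormulaZ2.Cruxes.BoundaryDefectGaussianR.RainbowMonomialsInExcursionKernels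

end
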